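import Summits.QuantumAdvantage.QuantumAdvantage.Theorems.SosSandwichPseudoBoundedAAClassicalCornerSpectralL1
import Literature.Computability.Complexity.FourierDegreeAlgebra
import HarnessLib

/-!
# Crux `PseudoBoundedAA` (stmt-QuantumAdvantage-15237, route SosSandwich) — classical corner: the DUALITY form of the
# per-tree route, `4·Cov[F,g]² ≤ Φ(t)·Σⱼ δⱼ(t) Infⱼ[g]` with `Φ(t) = Σ_S F̂(S)²/δ_t(S)`, and `C₀ ≤ 4·max_k Φ(t_k)`

Support file (`--supports stmt-QuantumAdvantage-15237`), sequel of `…ClassicalCornerSpectralL1.lean` and of the no-go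
files `…ClassicalCornerL2OSSSNoGo{,Balanced}.lean`.  Those show that the per-tree constant
`sup_g Cov[F,g]²/Σⱼδⱼ(t)Infⱼ[g]` is unbounded over trees; this file proves the matching UPPER bound for a fixed tree and
its consequence for mixtures, in Fourier language (`cubeFourierCoeff`, `walsh`; query weights
`δⱼ(t) = #{x : j ∈ t.queries x}/2^N`, `δ_t(S) = Σ_{j∈S} δⱼ(t)`):

* `cubeFourierCoeff_add`, `sum_cubeFourierCoeff_mul` (bilinear Parseval by polarisation), `covFourier_eq`
  (`Σ_{S≠∅} F̂(S)ĝ(S) = E[Fg] − E F·E g`);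
* `queryWeight_pos_of_coeff_ne_zero` — `F̂(S) ≠ 0, S ≠ ∅ ⇒ δ_t(S) > 0` (from `|F̂(S)| ≤ Pr[S ⊆ t.queries x]`);
* **`four_cov_sq_le_phi_mul`** — for every tree `t` (output `F`) and every real `g`:
  `Cov² = (E[Fg] − E F E g)² ≤ Φ(t) · Σ_S ĝ(S)² δ_t(S) = Φ(t) · ¼ Σⱼ δⱼ(t) Infⱼ[g]`, i.e.
  `4·Cov² ≤ (Σ_{S≠∅} F̂(S)²/δ_t(S)) · Σⱼ δⱼ(t) Infⱼ[g]` (Cauchy–Schwarz across the spectrum);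
* **`sixteen_var_sq_le_four_phiMax_mul`** — for a mixture `p = Σ_k w_k F_k` (`w ≥ 0`, `Σ w ≤ 1`) whose trees all have
  `Φ(t_k) ≤ M`: `16·Var[p]² ≤ 4M · Σⱼ δ̄ⱼ Infⱼ[p]`.  So the census's constant obeys `C₀(class) ≤ 4·sup Φ` over the trees
  allowed in the class (e.g. depth `≤ 2`: `Φ ≤ ⅓`, attained by the address function, whence the hands' `4/3`), while
  `not_exists_bilinear_osss` says `sup Φ = ∞` over all trees: the per-tree route yields depth-dependent constants only.

Honest label: calibration inside the classical corner of an open conjecture; no stub, crux or summit is closed.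
Sources: R. O'Donnell, *Analysis of Boolean Functions* (2014) §1.4, Thm 2.20, §3.4, §8.6; O'Donnell–Saks–Schramm–
Servedio, FOCS 2005, Thm 3.2.
-/

set_option linter.dupNamespace false

noncomputable section

namespace Summit.QuantumAdvantage.QuantumAdvantage.Theorems.SosSandwich

open Finset Function
open Literature.Computability.Complexity
open Literature.Probability.RandomGraphs.LowDegree (walsh sgn)
open Literature.Computability.Complexity.LowDegree (cubeFourierCoeff)

namespace ClassicalCornerSpectralDuality

variable {N : ℕ}

/-! ### Bilinear Parseval and the covariance in Fourier terms -/

/-- Additivity of Fourier coefficients. [cite: ODonnell2014, §1.2] -/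
theorem cubeFourierCoeff_add (F g : (Fin N → Bool) → ℝ) (S : Finset (Fin N)) :
    cubeFourierCoeff (fun x => F x + g x) S = cubeFourierCoeff F S + cubeFourierCoeff g S := by
  unfold cubeFourierCoeff
  rw [← add_div, ← Finset.sum_add_distrib]
  congr 1
  exact Finset.sum_congr rfl fun x _ => by ring

/-- **Bilinear Parseval**: `Σ_S F̂(S) ĝ(S) = E[F g]` (polarisation of Parseval). [cite: ODonnell2014, §1.4] -/
theorem sum_cubeFourierCoeff_mul (F g : (Fin N → Bool) → ℝ) :
    ∑ S, cubeFourierCoeff F S * cubeFourierCoeff g S = (∑ x, F x * g x) / (2 : ℝ) ^ N := by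
  have hp := LowDegree.sum_cubeFourierCoeff_sq (fun x => F x + g x)
  have hF := LowDegree.sum_cubeFourierCoeff_sq F
  have hg := LowDegree.sum_cubeFourierCoeff_sq g
  simp only [cubeFourierCoeff_add] at hp
  have hpol : ∑ S, cubeFourierCoeff F S * cubeFourierCoeff g S =
      ((∑ S : Finset (Fin N), (cubeFourierCoeff F S + cubeFourierCoeff g S) ^ 2) -
        (∑ S : Finset (Fin N), cubeFourierCoeff F S ^ 2) - ∑ S : Finset (Fin N), cubeFourierCoeff g S ^ 2) / 2 := by
    rw [← Finset.sum_sub_distrib, ← Finset.sum_sub_distrib, Finset.sum_div]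
    exact Finset.sum_congr rfl fun S _ => by ring
  rw [hpol, hp, hF, hg, ← sub_div, ← sub_div, ← Finset.sum_sub_distrib, ← Finset.sum_sub_distrib]
  rw [Finset.sum_congr rfl fun x _ => show (F x + g x) ^ 2 - F x ^ 2 - g x ^ 2 = 2 * (F x * g x) by ring,
    ← Finset.mul_sum]
  ring

/-- **Covariance in Fourier terms**: `Σ_{S≠∅} F̂(S) ĝ(S) = E[Fg] − E F · E g`. [cite: ODonnell2014, §1.4] -/
theorem covFourier_eq (F g : (Fin N → Bool) → ℝ) :
    ∑ S ∈ Finset.univ.filter (fun S : Finset (Fin N) => S.Nonempty), cubeFourierCoeff F S * cubeFourierCoeff g S =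
      (∑ x, F x * g x) / (2 : ℝ) ^ N - ((∑ x, F x) / (2 : ℝ) ^ N) * ((∑ x, g x) / (2 : ℝ) ^ N) := by
  classical
  rw [← sum_cubeFourierCoeff_mul, ← LowDegree.cubeFourierCoeff_empty, ← LowDegree.cubeFourierCoeff_empty]
  have hsplit := Finset.sum_filter_add_sum_filter_not Finset.univ (fun S : Finset (Fin N) => S.Nonempty)
    (fun S => cubeFourierCoeff F S * cubeFourierCoeff g S)
  have hempty : ∑ S ∈ Finset.univ.filter (fun S : Finset (Fin N) => ¬ S.Nonempty),
      cubeFourierCoeff F S * cubeFourierCoeff g S = cubeFourierCoeff F ∅ * cubeFourierCoeff g ∅ := by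
    have hset : Finset.univ.filter (fun S : Finset (Fin N) => ¬ S.Nonempty) = {∅} := by
      ext S
      simp [Finset.not_nonempty_iff_eq_empty]
    rw [hset, Finset.sum_singleton]
  rw [← hsplit, hempty]
  ring

/-! ### The per-tree duality bound -/

/-- A tree's output has no Fourier mass where the tree never reads: if `F̂(S) ≠ 0` and `S ≠ ∅` then
`δ_t(S) = Σ_{j∈S} δⱼ(t) > 0`. [cite: ODonnell2014, §3.4] -/
theorem queryWeight_pos_of_coeff_ne_zero (t : DecisionTree N) (F : (Fin N → Bool) → ℝ)
    (hF : ∀ x, F x = if t.eval x = true then (1 : ℝ) else 0) {S : Finset (Fin N)} (hS : S.Nonempty)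
    (hc : cubeFourierCoeff F S ≠ 0) :
    0 < ∑ j ∈ S, ((Finset.univ.filter fun x : Fin N → Bool => j ∈ t.queries x).card : ℝ) / (2 : ℝ) ^ N := by
  classical
  have hb := ClassicalCornerFourierQueries.abs_sum_mul_walsh_le_card_queries t F hF S
  have hne : (Finset.univ.filter fun x : Fin N → Bool => S ⊆ t.queries x).Nonempty := by
    rw [← Finset.card_pos]
    by_contra h
    push Not at h
    have h0 : (Finset.univ.filter fun x : Fin N → Bool => S ⊆ t.queries x).card = 0 := by omega
    rw [h0, Nat.cast_zero] at hb
    have hz : ∑ x, F x * walsh S x = 0 := abs_nonpos_iff.mp hb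
    apply hc
    unfold cubeFourierCoeff
    rw [hz, zero_div]
  obtain ⟨x, hx⟩ := hne
  rw [Finset.mem_filter] at hx
  obtain ⟨j, hj⟩ := hS
  have hjpos : 0 < ((Finset.univ.filter fun y : Fin N → Bool => j ∈ t.queries y).card : ℝ) / (2 : ℝ) ^ N := by
    apply div_pos _ (by positivity)
    exact_mod_cast Finset.card_pos.mpr ⟨x, Finset.mem_filter.mpr ⟨Finset.mem_univ _, hx.2 hj⟩⟩
  exact lt_of_lt_of_le hjpos (Finset.single_le_sum
    (f := fun i => ((Finset.univ.filter fun y : Fin N → Bool => i ∈ t.queries y).card : ℝ) / (2 : ℝ) ^ N)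
    (fun i _ => by positivity) hj)

/-- **Duality bound for one tree.** For a decision tree `t` with `0/1` output `F`, every real `g`, and the tree's
spectral constant `Φ(t) = Σ_{S≠∅} F̂(S)²/δ_t(S)`:
`(E[Fg] − E F·E g)² ≤ Φ(t) · Σ_S ĝ(S)² δ_t(S) = Φ(t) · ¼ Σⱼ δⱼ(t)·E(g(x^{j→1}) − g(x^{j→0}))²`, stated as
`4·(E[Fg] − E F·E g)² ≤ Φ(t) · Σⱼ δⱼ(t)·E(g(x^{j→1}) − g(x^{j→0}))²`.
[cite: ODonnell2014, §3.4, §8.6] -/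
theorem four_cov_sq_le_phi_mul (t : DecisionTree N) (F g : (Fin N → Bool) → ℝ)
    (hF : ∀ x, F x = if t.eval x = true then (1 : ℝ) else 0) :
    4 * ((∑ x, F x * g x) / (2 : ℝ) ^ N - ((∑ x, F x) / (2 : ℝ) ^ N) * ((∑ x, g x) / (2 : ℝ) ^ N)) ^ 2 ≤
      (∑ S ∈ Finset.univ.filter (fun S : Finset (Fin N) => S.Nonempty), cubeFourierCoeff F S ^ 2 /
          ∑ j ∈ S, ((Finset.univ.filter fun x : Fin N → Bool => j ∈ t.queries x).card : ℝ) / (2 : ℝ) ^ N) *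
        ∑ j, (((Finset.univ.filter fun x : Fin N → Bool => j ∈ t.queries x).card : ℝ) / (2 : ℝ) ^ N) *
          ((∑ x, (g (update x j true) - g (update x j false)) ^ 2) / (2 : ℝ) ^ N) := by
  classical
  set δ : Fin N → ℝ := fun j => ((Finset.univ.filter fun x : Fin N → Bool => j ∈ t.queries x).card : ℝ) / (2 : ℝ) ^ N
    with hδ
  have hδ0 : ∀ j, 0 ≤ δ j := fun j => by positivity
  -- Cauchy–Schwarz with `a_S = F̂(S)/√δ(S)`, `b_S = ĝ(S)√δ(S)`
  set a : Finset (Fin N) → ℝ := fun S => cubeFourierCoeff F S / Real.sqrt (∑ j ∈ S, δ j) with ha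
  set b : Finset (Fin N) → ℝ := fun S => cubeFourierCoeff g S * Real.sqrt (∑ j ∈ S, δ j) with hb
  have hab : ∀ S ∈ Finset.univ.filter (fun S : Finset (Fin N) => S.Nonempty),
      a S * b S = cubeFourierCoeff F S * cubeFourierCoeff g S := by
    intro S hS
    rw [Finset.mem_filter] at hS
    by_cases hc : cubeFourierCoeff F S = 0
    · simp [ha, hb, hc]
    · have hpos : 0 < ∑ j ∈ S, δ j := queryWeight_pos_of_coeff_ne_zero t F hF hS.2 hc
      have hsq : Real.sqrt (∑ j ∈ S, δ j) ≠ 0 := (Real.sqrt_pos.mpr hpos).ne'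
      simp only [ha, hb]
      field_simp
  have ha2 : ∀ S ∈ Finset.univ.filter (fun S : Finset (Fin N) => S.Nonempty),
      a S ^ 2 = cubeFourierCoeff F S ^ 2 / ∑ j ∈ S, δ j := by
    intro S hS
    rw [Finset.mem_filter] at hS
    by_cases hc : cubeFourierCoeff F S = 0
    · simp [ha, hc]
    · have hpos : 0 < ∑ j ∈ S, δ j := queryWeight_pos_of_coeff_ne_zero t F hF hS.2 hc
      simp only [ha]
      rw [div_pow, Real.sq_sqrt hpos.le]
  have hb2 : ∀ S, b S ^ 2 = cubeFourierCoeff g S ^ 2 * ∑ j ∈ S, δ j := by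
    intro S
    simp only [hb]
    rw [mul_pow, Real.sq_sqrt (Finset.sum_nonneg fun j _ => hδ0 j)]
  have hcov := covFourier_eq F g
  rw [← Finset.sum_congr rfl hab] at hcov
  have hCS := Finset.sum_mul_sq_le_sq_mul_sq (Finset.univ.filter (fun S : Finset (Fin N) => S.Nonempty)) a b
  rw [hcov, Finset.sum_congr rfl ha2, Finset.sum_congr rfl fun S _ => hb2 S] at hCS
  -- `Σ_{S≠∅} ĝ² δ(S) ≤ Σ_S ĝ² δ(S) = ¼ Σ_j δ_j Inf_j`
  have hdrop : ∑ S ∈ Finset.univ.filter (fun S : Finset (Fin N) => S.Nonempty),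
      cubeFourierCoeff g S ^ 2 * ∑ j ∈ S, δ j ≤ ∑ S, cubeFourierCoeff g S ^ 2 * ∑ j ∈ S, δ j :=
    Finset.sum_le_sum_of_subset_of_nonneg (Finset.filter_subset _ _)
      fun S _ _ => mul_nonneg (sq_nonneg _) (Finset.sum_nonneg fun j _ => hδ0 j)
  have hw := ClassicalCornerSpectralL1.sum_sq_mul_weight_eq g δ
  have hΦ0 : 0 ≤ ∑ S ∈ Finset.univ.filter (fun S : Finset (Fin N) => S.Nonempty),
      cubeFourierCoeff F S ^ 2 / ∑ j ∈ S, δ j :=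
    Finset.sum_nonneg fun S _ => div_nonneg (sq_nonneg _) (Finset.sum_nonneg fun j _ => hδ0 j)
  calc 4 * ((∑ x, F x * g x) / (2 : ℝ) ^ N - ((∑ x, F x) / (2 : ℝ) ^ N) * ((∑ x, g x) / (2 : ℝ) ^ N)) ^ 2
      ≤ 4 * ((∑ S ∈ Finset.univ.filter (fun S : Finset (Fin N) => S.Nonempty),
            cubeFourierCoeff F S ^ 2 / ∑ j ∈ S, δ j) *
          ∑ S, cubeFourierCoeff g S ^ 2 * ∑ j ∈ S, δ j) := by
        nlinarith [mul_le_mul_of_nonneg_left hdrop hΦ0]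
    _ = (∑ S ∈ Finset.univ.filter (fun S : Finset (Fin N) => S.Nonempty),
            cubeFourierCoeff F S ^ 2 / ∑ j ∈ S, δ j) *
          ∑ j, δ j * ((∑ x, (g (update x j true) - g (update x j false)) ^ 2) / (2 : ℝ) ^ N) := by
        rw [hw]; ring

/-! ### Mixtures: `C₀ ≤ 4 · max_k Φ(t_k)` -/

/-- **The per-tree route, made quantitative.**  If `p = Σ_{k∈s} w_k F_k` (`w ≥ 0`, `Σ w ≤ 1`, `F_k` the `0/1` output of
`t_k`) and every tree has spectral constant `Φ(t_k) ≤ M`, then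
`16·Var[p]² ≤ 4M · Σⱼ δ̄ⱼ Infⱼ[p]` (`Var[p] = Σ_{S≠∅} p̂(S)²`, `δ̄ⱼ = Σ_k w_k δⱼ(t_k)`,
`Infⱼ[p] = E(p(x^{j→1}) − p(x^{j→0}))²`): the census's constant for a class of trees is at most `4·sup Φ` over the class.
[cite: ODonnell2014, §8.6] [cite: OdonnellEtAl2005, Thm 3.2] -/
theorem sixteen_var_sq_le_four_phiMax_mul {ι : Type*} (s : Finset ι) (w : ι → ℝ) (hw : ∀ k ∈ s, 0 ≤ w k)
    (hw1 : ∑ k ∈ s, w k ≤ 1) (t : ι → DecisionTree N) (F : ι → (Fin N → Bool) → ℝ)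
    (hF : ∀ k x, F k x = if (t k).eval x = true then (1 : ℝ) else 0) (p : (Fin N → Bool) → ℝ)
    (hp : ∀ x, p x = ∑ k ∈ s, w k * F k x) (M : ℝ)
    (hM : ∀ k ∈ s, ∑ S ∈ Finset.univ.filter (fun S : Finset (Fin N) => S.Nonempty), cubeFourierCoeff (F k) S ^ 2 /
        ∑ j ∈ S, ((Finset.univ.filter fun x : Fin N → Bool => j ∈ (t k).queries x).card : ℝ) / (2 : ℝ) ^ N ≤ M) :
    16 * (∑ S ∈ Finset.univ.filter (fun S : Finset (Fin N) => S.Nonempty), cubeFourierCoeff p S ^ 2) ^ 2 ≤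
      4 * M * ∑ j, (∑ k ∈ s, w k *
          (((Finset.univ.filter fun x : Fin N → Bool => j ∈ (t k).queries x).card : ℝ) / (2 : ℝ) ^ N)) *
        ((∑ x, (p (update x j true) - p (update x j false)) ^ 2) / (2 : ℝ) ^ N) := by
  classical
  -- abbreviations
  set V : ℝ := ∑ S ∈ Finset.univ.filter (fun S : Finset (Fin N) => S.Nonempty), cubeFourierCoeff p S ^ 2 with hV
  set B : ι → ℝ := fun k => ∑ j, (((Finset.univ.filter fun x : Fin N → Bool => j ∈ (t k).queries x).card : ℝ) /
      (2 : ℝ) ^ N) * ((∑ x, (p (update x j true) - p (update x j false)) ^ 2) / (2 : ℝ) ^ N) with hB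
  set C : ι → ℝ := fun k => (∑ x, F k x * p x) / (2 : ℝ) ^ N -
      ((∑ x, F k x) / (2 : ℝ) ^ N) * ((∑ x, p x) / (2 : ℝ) ^ N) with hC
  have hB0 : ∀ k, 0 ≤ B k := fun k =>
    Finset.sum_nonneg fun j _ => mul_nonneg (by positivity) (div_nonneg (Finset.sum_nonneg fun x _ => sq_nonneg _)
      (by positivity))
  -- `V = Σ_k w_k Cov(F_k, p)` (linearity of the covariance in the first argument)
  have hlin : V = ∑ k ∈ s, w k * C k := by
    have hpc : ∀ S, cubeFourierCoeff p S = ∑ k ∈ s, w k * cubeFourierCoeff (F k) S := by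
      intro S
      have : p = fun x => ∑ k ∈ s, (fun y => w k * F k y) x := funext fun x => by rw [hp x]
      rw [this, LowDegree.cubeFourierCoeff_sum]
      refine Finset.sum_congr rfl fun k _ => ?_
      unfold cubeFourierCoeff
      rw [mul_div_assoc']
      congr 1
      rw [Finset.mul_sum]
      exact Finset.sum_congr rfl fun x _ => by ring
    simp only [hC]
    rw [Finset.sum_congr rfl fun k (_ : k ∈ s) => by rw [← covFourier_eq (F k) p]]
    simp only [hV]
    calc ∑ S ∈ Finset.univ.filter (fun S : Finset (Fin N) => S.Nonempty), cubeFourierCoeff p S ^ 2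
        = ∑ S ∈ Finset.univ.filter (fun S : Finset (Fin N) => S.Nonempty),
            ∑ k ∈ s, w k * (cubeFourierCoeff (F k) S * cubeFourierCoeff p S) := by
          refine Finset.sum_congr rfl fun S _ => ?_
          rw [sq, hpc S, Finset.sum_mul]
          exact Finset.sum_congr rfl fun k _ => by rw [← hpc S]; ring
      _ = ∑ k ∈ s, w k * ∑ S ∈ Finset.univ.filter (fun S : Finset (Fin N) => S.Nonempty),
            cubeFourierCoeff (F k) S * cubeFourierCoeff p S := by
          rw [Finset.sum_comm]
          exact Finset.sum_congr rfl fun k _ => by rw [Finset.mul_sum]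
  -- per tree: `4 C_k² ≤ M · B_k`, hence `C_k ≤ ½ √(M B_k)`
  have hM0 : ∀ k ∈ s, 0 ≤ M := by
    intro k hk
    refine le_trans (Finset.sum_nonneg fun S _ => div_nonneg (sq_nonneg _)
      (Finset.sum_nonneg fun j _ => by positivity)) (hM k hk)
  have hCk : ∀ k ∈ s, 4 * C k ^ 2 ≤ M * B k := by
    intro k hk
    have h := four_cov_sq_le_phi_mul (t k) (F k) p (hF k)
    exact h.trans (mul_le_mul_of_nonneg_right (hM k hk) (hB0 k))
  -- Cauchy–Schwarz over the mixture: `(Σ w C)² ≤ (Σ w)(Σ w C²) ≤ Σ w C² ≤ (M/4) Σ w B`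
  have hVsq : V ^ 2 ≤ (∑ k ∈ s, w k) * ∑ k ∈ s, w k * C k ^ 2 := by
    rw [hlin]
    have := Finset.sum_mul_sq_le_sq_mul_sq s (fun k => Real.sqrt (w k)) (fun k => Real.sqrt (w k) * C k)
    have e1 : ∀ k ∈ s, Real.sqrt (w k) * (Real.sqrt (w k) * C k) = w k * C k := by
      intro k hk; rw [← mul_assoc, Real.mul_self_sqrt (hw k hk)]
    have e2 : ∀ k ∈ s, Real.sqrt (w k) ^ 2 = w k := fun k hk => Real.sq_sqrt (hw k hk)
    have e3 : ∀ k ∈ s, (Real.sqrt (w k) * C k) ^ 2 = w k * C k ^ 2 := by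
      intro k hk; rw [mul_pow, Real.sq_sqrt (hw k hk)]
    rw [Finset.sum_congr rfl e1, Finset.sum_congr rfl e2, Finset.sum_congr rfl e3] at this
    exact this
  have hsum : ∑ k ∈ s, w k * C k ^ 2 ≤ (M / 4) * ∑ k ∈ s, w k * B k := by
    rw [Finset.mul_sum]
    refine Finset.sum_le_sum fun k hk => ?_
    have := hCk k hk
    have hwk := hw k hk
    nlinarith
  have hwC0 : 0 ≤ ∑ k ∈ s, w k * C k ^ 2 := Finset.sum_nonneg fun k hk => mul_nonneg (hw k hk) (sq_nonneg _)
  -- `Σ_k w_k B_k = Σ_j δ̄_j Inf_j`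
  have hBsum : ∑ k ∈ s, w k * B k = ∑ j, (∑ k ∈ s, w k *
      (((Finset.univ.filter fun x : Fin N → Bool => j ∈ (t k).queries x).card : ℝ) / (2 : ℝ) ^ N)) *
        ((∑ x, (p (update x j true) - p (update x j false)) ^ 2) / (2 : ℝ) ^ N) := by
    simp only [hB]
    calc ∑ k ∈ s, w k * ∑ j, (((Finset.univ.filter fun x : Fin N → Bool => j ∈ (t k).queries x).card : ℝ) /
          (2 : ℝ) ^ N) * ((∑ x, (p (update x j true) - p (update x j false)) ^ 2) / (2 : ℝ) ^ N)
        = ∑ k ∈ s, ∑ j, w k * ((((Finset.univ.filter fun x : Fin N → Bool => j ∈ (t k).queries x).card : ℝ) /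
          (2 : ℝ) ^ N) * ((∑ x, (p (update x j true) - p (update x j false)) ^ 2) / (2 : ℝ) ^ N)) := by
          refine Finset.sum_congr rfl fun k _ => ?_
          rw [Finset.mul_sum]
      _ = ∑ j, ∑ k ∈ s, w k * ((((Finset.univ.filter fun x : Fin N → Bool => j ∈ (t k).queries x).card : ℝ) /
          (2 : ℝ) ^ N) * ((∑ x, (p (update x j true) - p (update x j false)) ^ 2) / (2 : ℝ) ^ N)) := Finset.sum_comm
      _ = _ := by
          refine Finset.sum_congr rfl fun j _ => ?_
          rw [Finset.sum_mul]
          exact Finset.sum_congr rfl fun k _ => by ring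
  calc 16 * V ^ 2 ≤ 16 * ((∑ k ∈ s, w k) * ∑ k ∈ s, w k * C k ^ 2) := by nlinarith
    _ ≤ 16 * (1 * ∑ k ∈ s, w k * C k ^ 2) := by
        nlinarith [mul_le_mul_of_nonneg_right hw1 hwC0]
    _ ≤ 16 * ((M / 4) * ∑ k ∈ s, w k * B k) := by nlinarith
    _ = 4 * M * ∑ k ∈ s, w k * B k := by ring
    _ = _ := by rw [hBsum]

end ClassicalCornerSpectralDuality

end Summit.QuantumAdvantage.QuantumAdvantage.Theorems.SosSandwich

end
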